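import Literature.NumberTheory.Sieve.HeathBrownCubicLemma92Chi
import Literature.NumberTheory.Sieve.HeathBrownCubicLemma93Main
import Literature.NumberTheory.Sieve.HeathBrownCubicLemma93Twisted
import Literature.NumberTheory.Sieve.HeathBrownCubicWindowIntegral
import HarnessLib

/-!
# Lemma 9.2 on one cube with explicit constants (from Lemma 9.4-type prime sums)

Part of the reduction *Lemma 9.2 ⇐ Lemma 9.4* in §9 of D. R. Heath-Brown, *Primes represented by `x³ + 2y³`*,
Acta Math. 186 (2001) (this seat's route to the named fact `HeathBrown2001_lemma_3_8`). Lemma 9.2 (p. 52): "Let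
`exp{(log log X)^{1/2}} ≤ V ≤ X²` … and `d_S` given by (3.11) … `∑_{β̂∈𝒞, β≡α (mod q)} d_{(β)} = γ₀⁻¹M⁻¹φ_K(q)⁻¹(ξ log X)^{−n−1}𝓘
+ O(V exp{−c(log L)^{1/2}})` uniformly for `q ≤ (log L)^A`", proved on pp. 52–60 from Lemma 9.3 (itself from Lemma 9.4,
Mitsui's prime number theorem with Grössencharaktere, and Lemma 4.10) through (9.1) and (9.15)–(9.22). This file
ASSEMBLES the explicit, non-asymptotic form of that argument on one cube from the tree's pieces, with the twisted prime
sums entering only as the hypothesis `hθ` (`|θ_ν(u)| ≤ C₉ue^{−c₉√(log u)}` for the non-trivial `ν = ν^{(j,k)}χ`,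
`|j|, |k| < K₀`, `u ≥ A₀` — the conclusion of Lemma 9.4 in the form `GrossenCharPNT` of `HeathBrownCubicGrossenPrimeSums`):

* the explicit error pieces `nMax`, `bB1` ((9.9)), `bB2` ((9.6)), `bEA` ((9.10)), `bErr` (Lemma 9.3), `bErr8` ((9.18)–(9.19)),
  `bSmallR`, `bRho`, `bG` ((9.21)–(9.22)) and **`lemma92Bound = G + Err·S₀³/(γ₀Δ³V) + err₈/(γ₀ΔV·M(ξ log X)^{n+1})`**;
* `normForm_bounds_of_cubeCond` (`c₄V ≤ N ≤ 13c₃³V` on `𝒞`), `card_boundary_le'` (uniform boundary count);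
* **`norm_Tchi_sub_le_bound`** — for every `χ mod q`: `|T(χ) − ε(χ)𝓘/(γ₀M(ξ log X)^{n+1})| ≤ lemma92Bound`
  (`Jint_eq_sum_Jv`, `norm_sum_Jv_sub_le`, `norm_Esum_sub_main_le` with `norm_Ejk_le_of_theta`/`norm_Ejk_one_sub_main_le`/
  `abs_Eabs_sub_main_le`, `norm_Jint_sub_main_le`, the window integrals, `norm_Tchi_sub_main_le`);
* (9.1): `hasEnoughRootsOfUnity_quotMod`, `sum_mulChar_apply_eq`, `sum_mulChar_inv_mul_eq` (orthogonality of the characters of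
  `(𝓞_K/(q))ˣ`, after Mathlib's `DirichletCharacter.sum_char_inv_mul_char_eq`), `cubeClassSum_eq_sum_Tchi`;
* **`abs_cubeClassSum_sub_swMainTerm_le_bound`** — Lemma 9.2 on one cube: for `α` coprime to `q`,
  `|cubeClassSum d q α − swMainTerm| ≤ lemma92Bound`.

The choice `Δ = exp{−c'√(log L)}`, `K₀`, `A₀ = X^τ/2` and the verification that `lemma92Bound ≪ V e^{−c√(log L)}` for
`X ≥ X₀` (p. 60) are in the sequel.

## References

* D. R. Heath-Brown, *Primes represented by `x³ + 2y³`*, Acta Math. 186 (2001), Lemma 9.2 (p. 52) and §9 pp. 52–60.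
  [cite: HeathBrownActa2001, Lemma 9.2]

## Mathlib / tree search

Tree: all of `HeathBrownCubicLemma92Chi`/`Orbit`/`Lattice`, `HeathBrownCubicLemma93Core`/`Main`/`Twisted`, `HeathBrownCubicWindowIntegral`,
`cubeClassSum`, `swMainTerm`, `eulerPhiK`, `cubeIntegral` (`HeathBrownCubicSiegelWalfisz`), `finite_quotMod`, `isUnit_toQuotMod_iff`,
`norm_mulChar_apply_units` (`HeathBrownCubicGrossen`), `sum_norm_tentCoeff_le` (`TentFunction`). Mathlib:
`MulChar.exists_apply_ne_one_of_hasEnoughRootsOfUnity`, `MulChar.card_eq_card_units_of_hasEnoughRootsOfUnity`,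
`IsSepClosed.hasEnoughRootsOfUnity`, `Monoid.exponent_ne_zero_of_finite`, `Ideal.Quotient.eq`.
-/

noncomputable section

open Polynomial NumberField Finset Complex MeasureTheory

namespace Literature.NumberTheory.Sieve.CubicSieve

open LFunctions.CubeRootTwoField LFunctions.NumberField CubicPrimes Literature.Analysis.Fourier

/-! ### The explicit error terms -/

section Bounds

variable (X τ : ℝ) {n : ℕ} (m : Fin (n + 1) → ℕ)

/-- `N₁ = (13c₃³ + 1)V ≥ N(𝐱) + ΔV` on the cube (`Δ ≤ 1`). [folklore] -/
def nMax (c₃ V : ℝ) : ℝ := (13 * c₃ ^ 3 + 1) * V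

/-- The bound `B₁` for the non-trivial `E_{j,k}` ((9.9), `norm_Ejk_le_of_theta` at `N(𝐱)+ΔV ≤ N₁`). [cite: HeathBrownActa2001, §9 (9.9)] -/
def bB1 (c₃ V A₀ C₉ c₉ Cθ cθ : ℝ) : ℝ :=
  nMax c₃ V * (2 * C₉ * Real.exp (-(c₉ * Real.sqrt (Real.log A₀))) + 12 * (3 / 2 * Real.log X) / Real.sqrt A₀) *
    (1 + (Cθ * Real.exp (-cθ * Real.sqrt (τ * Real.log X)) + (8 + 2 * Cθ) / (hbXi τ * Real.log X))) ^ n /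
    ((∏ i, (m i : ℝ)) * (hbXi τ * Real.log X))

/-- The bound `B₂` for `E_{0,0} − m/M₀` and for `Eabs − m/M₀` ((9.6), at `N(𝐱)+ΔV ≤ N₁`). [cite: HeathBrownActa2001, §9 (9.6)] -/
def bB2 (c₃ V c₁ c₂ C₄ : ℝ) : ℝ :=
  2 * (C₄ * ((n : ℝ) + 1) * nMax c₃ V * (c₁ + hbXi τ * Real.log X) ^ n * Real.exp (-c₂ * Real.sqrt (τ * Real.log X))) /
    ((∏ i, (m i : ℝ)) * (hbXi τ * Real.log X) ^ (n + 1))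

/-- The bound for `Eabs` ((9.10): `m(𝐱)/M₀ ≤ ΔV/(Mξ log X)`, plus `B₂`). [cite: HeathBrownActa2001, §9 (9.10)] -/
def bEA (c₃ V Δ c₁ c₂ C₄ : ℝ) : ℝ := Δ * V / ((∏ i, (m i : ℝ)) * (hbXi τ * Real.log X)) + bB2 X τ m c₃ V c₁ c₂ C₄

/-- The uniform bound `Err` for `|E(𝐱) − ε(χ)Δ²m(𝐱)/M₀|` on the cube (Lemma 9.3, `norm_Esum_sub_main_le`).
[cite: HeathBrownActa2001, Lemma 9.3] -/
def bErr (c₃ V Δ : ℝ) (K₀ : ℕ) (A₀ C₉ c₉ Cθ cθ c₁ c₂ C₄ : ℝ) : ℝ :=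
  3 * (1 / Δ / Real.sqrt K₀) * bEA X τ m c₃ V Δ c₁ c₂ C₄ + ((1 + 1 / Δ) ^ 2 + 1) * bB1 X τ m c₃ V A₀ C₉ c₉ Cθ cθ +
    Δ ^ 2 * bB2 X τ m c₃ V c₁ c₂ C₄

/-- The bound `err₈` for `|∫_𝒞 m − ΔV𝓘|` (both cases of `HeathBrownCubicWindowIntegral` added). [cite: HeathBrownActa2001, §9 (9.18)–(9.19)] -/
def bErr8 (c₃ c₄ V Δ S₀ : ℝ) : ℝ :=
  Δ * V * (2 * (18 * (Δ * V) * S₀ ^ 2 * (c₃ * V ^ (1 / 3 : ℝ)) / (c₄ * V))) +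
    2 * Δ ^ 2 * V / c₄ * (hbXi τ * Real.log X) ^ (n - 1) * S₀ ^ 3

/-- The enlargement `r = 2C₀(1 + c₄⁻¹)Δ·c₃V^{1/3}`. [cite: HeathBrownActa2001, Lemma 9.5] -/
def bSmallR (c₃ c₄ C₀ Δ V : ℝ) : ℝ := 2 * (C₀ * (1 + 1 / c₄) * Δ) * (c₃ * V ^ (1 / 3 : ℝ))

/-- The boundary thickness `ρ = C₀(1 + 2/c₄)ΔR`, `R = 5c₃V^{1/3} + 2r`. [cite: HeathBrownActa2001, §9 p. 59] -/
def bRho (c₃ c₄ C₀ Δ V : ℝ) : ℝ := C₀ * (1 + 1 / (c₄ / 2)) * Δ * (5 * (c₃ * V ^ (1 / 3 : ℝ)) + 2 * bSmallR c₃ c₄ C₀ Δ V)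

/-- The lattice-count error `G = 16πΔ(S₀ + 3r + 1)³ + 64(S₀ + 2ρ + 1)²(2ρ + 1)`. [cite: HeathBrownActa2001, §9 (9.21)–(9.22)] -/
def bG (c₃ c₄ C₀ Δ V S₀ : ℝ) : ℝ :=
  16 * Real.pi * Δ * (S₀ + 3 * bSmallR c₃ c₄ C₀ Δ V + 1) ^ 3 +
    64 * ((S₀ + 2 * bRho c₃ c₄ C₀ Δ V + 1) ^ 2 * (2 * bRho c₃ c₄ C₀ Δ V + 1))

/-- **The explicit error of Lemma 9.2 on one cube, for one character**:
`G + Err·S₀³/(γ₀Δ³V) + err₈/(γ₀ΔV·M(ξ log X)^{n+1})`. [cite: HeathBrownActa2001, §9 p. 60] -/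
def lemma92Bound (c₃ c₄ V Δ S₀ : ℝ) (K₀ : ℕ) (A₀ C₉ c₉ Cθ cθ c₁ c₂ C₄ C₀ : ℝ) : ℝ :=
  bG c₃ c₄ C₀ Δ V S₀ + bErr X τ m c₃ V Δ K₀ A₀ C₉ c₉ Cθ cθ c₁ c₂ C₄ * S₀ ^ 3 / (gamma₀ * Δ ^ 3 * V) +
    bErr8 X τ (n := n) c₃ c₄ V Δ S₀ / (gamma₀ * Δ * V * ((∏ i, (m i : ℝ)) * (hbXi τ * Real.log X) ^ (n + 1)))

end Bounds

/-! ### Auxiliary bounds on the cube -/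

/-- On the cube: `c₄V ≤ N(𝐱) ≤ 13c₃³V`. [folklore] -/
theorem normForm_bounds_of_cubeCond {c₃ c₄ V : ℝ} (hV : 0 ≤ V) {a : ℝ × ℝ × ℝ} {S₀ : ℝ} (hcube : CubeCond c₃ c₄ V a S₀)
    {x : ℝ × ℝ × ℝ} (hx : x ∈ realCube a S₀) : c₄ * V ≤ normForm x ∧ normForm x ≤ 13 * c₃ ^ 3 * V := by
  obtain ⟨h1, h2, h3, h4⟩ := hcube x hx
  refine ⟨by rw [normForm]; exact h4, ?_⟩
  set s := c₃ * V ^ (1 / 3 : ℝ) with hs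
  have hs0 : 0 ≤ s := (abs_nonneg _).trans h1
  have hs3 : s ^ 3 = c₃ ^ 3 * V := by
    rw [hs, mul_pow, ← Real.rpow_natCast (V ^ (1 / 3 : ℝ)) 3, ← Real.rpow_mul hV]; norm_num
  rw [normForm]
  rw [abs_le] at h1 h2 h3
  have hb1 : |x.1| ≤ s := abs_le.mpr h1
  have hb2 : |x.2.1| ≤ s := abs_le.mpr h2
  have hb3 : |x.2.2| ≤ s := abs_le.mpr h3
  have e1 : x.1 ^ 3 ≤ s ^ 3 := by
    calc x.1 ^ 3 ≤ |x.1| ^ 3 := by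
          rcases le_or_gt 0 x.1 with h | h
          · rw [abs_of_nonneg h]
          · have : x.1 ^ 3 ≤ 0 := by nlinarith [sq_nonneg x.1]
            exact this.trans (pow_nonneg (abs_nonneg _) 3)
      _ ≤ s ^ 3 := pow_le_pow_left₀ (abs_nonneg _) hb1 3
  have e2 : x.2.1 ^ 3 ≤ s ^ 3 := by
    calc x.2.1 ^ 3 ≤ |x.2.1| ^ 3 := by
          rcases le_or_gt 0 x.2.1 with h | h
          · rw [abs_of_nonneg h]
          · have : x.2.1 ^ 3 ≤ 0 := by nlinarith [sq_nonneg x.2.1]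
            exact this.trans (pow_nonneg (abs_nonneg _) 3)
      _ ≤ s ^ 3 := pow_le_pow_left₀ (abs_nonneg _) hb2 3
  have e3 : x.2.2 ^ 3 ≤ s ^ 3 := by
    calc x.2.2 ^ 3 ≤ |x.2.2| ^ 3 := by
          rcases le_or_gt 0 x.2.2 with h | h
          · rw [abs_of_nonneg h]
          · have : x.2.2 ^ 3 ≤ 0 := by nlinarith [sq_nonneg x.2.2]
            exact this.trans (pow_nonneg (abs_nonneg _) 3)
      _ ≤ s ^ 3 := pow_le_pow_left₀ (abs_nonneg _) hb3 3
  have e4 : -(6 * x.1 * x.2.1 * x.2.2) ≤ 6 * s ^ 3 := by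
    have : |x.1 * x.2.1 * x.2.2| ≤ s ^ 3 := by
      rw [abs_mul, abs_mul, pow_succ, pow_two]
      exact mul_le_mul (mul_le_mul hb1 hb2 (abs_nonneg _) hs0) hb3 (abs_nonneg _) (mul_nonneg hs0 hs0)
    have := neg_abs_le (x.1 * x.2.1 * x.2.2); linarith
  linarith

open scoped Classical in
/-- **The boundary count, uniform version**: `#{v ∈ outer ∖ inner} ≤ 8(S₀ + 2ρ + 1)²(2ρ + 1)` for all `S₀, ρ ≥ 0`.
[cite: HeathBrownActa2001, §9 p. 60] -/
theorem card_boundary_le' (a : ℝ × ℝ × ℝ) {S₀ ρ : ℝ} (hS₀ : 0 ≤ S₀) (hρ : 0 ≤ ρ) :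
    (((latticeCube (a.1 - ρ, a.2.1 - ρ, a.2.2 - ρ) (S₀ + 2 * ρ)).filter
        (fun v => castVec v ∉ realCube (a.1 + ρ, a.2.1 + ρ, a.2.2 + ρ) (S₀ - 2 * ρ))).card : ℝ) ≤
      8 * ((S₀ + 2 * ρ + 1) ^ 2 * (2 * ρ + 1)) := by
  rcases le_or_gt (2 * ρ + 1) S₀ with h | h
  · refine (card_boundary_le a hρ h).trans ?_
    have : S₀ ^ 2 ≤ (S₀ + 2 * ρ + 1) ^ 2 := by nlinarith
    nlinarith
  · calc (((latticeCube (a.1 - ρ, a.2.1 - ρ, a.2.2 - ρ) (S₀ + 2 * ρ)).filter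
          (fun v => castVec v ∉ realCube (a.1 + ρ, a.2.1 + ρ, a.2.2 + ρ) (S₀ - 2 * ρ))).card : ℝ)
        ≤ ((latticeCube (a.1 - ρ, a.2.1 - ρ, a.2.2 - ρ) (S₀ + 2 * ρ)).card : ℝ) := by
          exact_mod_cast Finset.card_filter_le _ _
      _ ≤ (S₀ + 2 * ρ + 1) ^ 3 := card_latticeCube_le _ (by positivity)
      _ = (S₀ + 2 * ρ + 1) ^ 2 * (S₀ + 2 * ρ + 1) := by ring
      _ ≤ (S₀ + 2 * ρ + 1) ^ 2 * (8 * (2 * ρ + 1)) := by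
          apply mul_le_mul_of_nonneg_left _ (sq_nonneg _); linarith
      _ = 8 * ((S₀ + 2 * ρ + 1) ^ 2 * (2 * ρ + 1)) := by ring

/-! ### Lemma 9.2 on one cube for one character -/

set_option maxHeartbeats 1000000 in
open scoped Classical in
/-- **Lemma 9.2 for one character, explicit** (pp. 52–60 assembled): under the side conditions listed, for every
character `χ mod q`,
`|T(χ) − ε(χ)·𝓘/(γ₀M(ξ log X)^{n+1})| ≤ lemma92Bound`, where the twisted prime sums enter only through the
hypothesis `hθ` (the conclusion of Lemma 9.4 for the non-trivial `ν^{(j,k)} mod q`, `|j|, |k| < K₀`, `u ≥ A₀`).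
[cite: HeathBrownActa2001, Lemma 9.2, §9 pp. 52–60] -/
theorem norm_Tchi_sub_le_bound
    {C₀ : ℝ} (h95 : Lemma95Bound C₀) (hC₀ : 0 < C₀)
    {c₁ c₂ C₄ : ℝ} (h410 : TupleCountBound c₁ c₂ C₄) (hc₁ : 0 ≤ c₁) (hC₄ : 0 ≤ C₄)
    {cθ Cθ : ℝ} (hcθ : 0 ≤ cθ) (hCθ : 0 ≤ Cθ)
    (hθ₁ : ∀ x : ℝ, 2 ≤ x → |degreeOneTheta K x - x| ≤ Cθ * x * Real.exp (-cθ * Real.sqrt (Real.log x)))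
    {X τ : ℝ} (hX : 1 < X) (hτ : 0 < τ) (hτ1 : τ ≤ 1) (h3 : 3 ≤ X ^ τ) {n : ℕ} {m : Fin (n + 1) → ℕ} (hm : CoreAdmissible τ m)
    {q : ℕ} (hq : 1 ≤ q) (hqX : (q : ℝ) ^ 3 < X ^ τ) (χ : MulChar (QuotMod q) ℂ)
    {K₀ : ℕ} (hK : 1 ≤ K₀) {A₀ C₉ c₉ : ℝ} (hA₀ : 1 ≤ A₀) (hA₀X : A₀ + 1 ≤ X ^ τ) (hc₉ : 0 ≤ c₉) (hC₉ : 0 ≤ C₉)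
    (hθ : ∀ (ψ : MulChar (QuotMod q) ℂ) (j k : ℤ), j ∈ Finset.Ioo (-(K₀ : ℤ)) K₀ → k ∈ Finset.Ioo (-(K₀ : ℤ)) K₀ →
      ¬ IsTrivialMod q (grossenChar hq ψ j k) → ∀ u : ℝ, A₀ ≤ u →
        ‖grossenTheta (grossenChar hq ψ j k) u‖ ≤ C₉ * u * Real.exp (-(c₉ * Real.sqrt (Real.log u))))
    {c₃ c₄ V Δ : ℝ} (hc₃ : 0 < c₃) (hc₄ : 0 < c₄) (hV : 0 < V) {a : ℝ × ℝ × ℝ} {S₀ : ℝ} (hS₀ : 0 < S₀)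
    (hcube : CubeCond c₃ c₄ V a S₀) (hΔ : 0 < Δ) (hΔ16 : Δ ≤ 1 / 16) (hΔc : Δ ≤ c₄ / 4)
    (hκ : C₀ * (1 + 1 / c₄) * Δ ≤ 1 / 2) (hε : 1 / Δ / Real.sqrt K₀ ≤ 1) :
    ‖Tchi χ X τ m a S₀ - (if χ = 1 then
        ((cubeIntegral X τ m a S₀ / (gamma₀ * ((∏ i, (m i : ℝ)) * (hbXi τ * Real.log X) ^ (n + 1))) : ℝ) : ℂ) else 0)‖ ≤
      lemma92Bound X τ m c₃ c₄ V Δ S₀ K₀ A₀ C₉ c₉ Cθ cθ c₁ c₂ C₄ C₀ := by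
  have hX0 : 0 < X := by linarith
  have hξ := hbXi_pos hτ
  have hlogX := Real.log_pos hX
  have hΔ2 : Δ ≤ 1 / 2 := by linarith
  have hΔ1 : Δ ≤ 1 := by linarith
  have hΔc2 : Δ ≤ c₄ / 2 := by linarith
  have hΔV : 0 ≤ Δ * V := by positivity
  have hγ := gamma₀_pos
  set M : ℝ := ∏ i, (m i : ℝ) with hMdef
  have hM1 : 1 ≤ M := one_le_prod_of_coreAdmissible hτ hτ1 hm
  set M₀ : ℝ := M * (hbXi τ * Real.log X) ^ (n + 1) with hM₀def
  have hM₀ : 0 < M₀ := by positivity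
  set r : ℝ := bSmallR c₃ c₄ C₀ Δ V with hrdef
  have hr0 : 0 ≤ r := by rw [hrdef, bSmallR]; positivity
  have hrle : 2 * (C₀ * (1 + 1 / c₄) * Δ) * (c₃ * V ^ (1 / 3 : ℝ)) ≤ r := le_of_eq (by rw [hrdef, bSmallR])
  set R : ℝ := 5 * (c₃ * V ^ (1 / 3 : ℝ)) + 2 * r with hRdef
  have hR0 : 0 ≤ R := by positivity
  have hR : ∀ v ∈ latticeCube (a.1 - 2 * r, a.2.1 - 2 * r, a.2.2 - 2 * r) (S₀ + 3 * r), ‖castVec v‖ ≤ R :=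
    fun v hv => norm_castVec_le_of_mem_bigCube hS₀ hcube hr0 hv
  have hρ : C₀ * (1 + 1 / (c₄ / 2)) * Δ * R = bRho c₃ c₄ C₀ Δ V := by rw [bRho, hRdef, hrdef]
  -- (i) and (ii)
  have hi := Jint_eq_sum_Jv (X := X) (τ := τ) (m := m) hq χ h95 hC₀ hc₄ hV hΔ hΔ16 hΔc2 hκ hcube hrle
  have hii' := norm_sum_Jv_sub_le (X := X) (τ := τ) (m := m) χ hq h95 hC₀ hc₄ hV hΔ hΔ16 hΔc hcube hX hτ hτ1 hm hr0 hR0 hR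
  rw [hρ] at hii'
  have hcardL : (((latticeCube (a.1 - 2 * r, a.2.1 - 2 * r, a.2.2 - 2 * r) (S₀ + 3 * r)).filter
      (fun v => 0 < ell (castVec v) ∧ Δ * V < normForm (castVec v))).card : ℝ) ≤ (S₀ + 3 * r + 1) ^ 3 := by
    refine le_trans ?_ (card_latticeCube_le (a.1 - 2 * r, a.2.1 - 2 * r, a.2.2 - 2 * r) (by positivity : (0 : ℝ) ≤ S₀ + 3 * r))
    exact_mod_cast Finset.card_filter_le _ _
  have hcardB := card_boundary_le' a hS₀.le (ρ := bRho c₃ c₄ C₀ Δ V) (by rw [← hρ]; positivity)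
  have hii : ‖∑ v ∈ (latticeCube (a.1 - 2 * r, a.2.1 - 2 * r, a.2.2 - 2 * r) (S₀ + 3 * r)).filter
        (fun v => 0 < ell (castVec v) ∧ Δ * V < normForm (castVec v)),
        (dWeight X τ m (Ideal.span {coordElt v}) : ℂ) * Jv χ Δ V a S₀ v -
        (gamma₀ * Δ ^ 3 * V : ℝ) * Tchi χ X τ m a S₀‖ ≤ gamma₀ * Δ ^ 3 * V * bG c₃ c₄ C₀ Δ V S₀ := by
    refine hii'.trans (mul_le_mul_of_nonneg_left ?_ (by positivity))
    rw [bG, ← hrdef]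
    have hπ := Real.pi_pos
    refine add_le_add (mul_le_mul_of_nonneg_left hcardL (by positivity)) ?_
    linarith [hcardB]
  -- (iii) the uniform bound on the cube
  have hN₁ : ∀ x ∈ realCube a S₀, normForm x + Δ * V ≤ nMax c₃ V ∧ 0 < normForm x := by
    intro x hx
    obtain ⟨hlo, hhi⟩ := normForm_bounds_of_cubeCond hV.le hcube hx
    refine ⟨?_, lt_of_lt_of_le (by positivity) hlo⟩
    rw [nMax]; nlinarith
  have hnMax0 : 0 ≤ nMax c₃ V := by rw [nMax]; positivity
  have hF0 : 0 ≤ 2 * C₉ * Real.exp (-(c₉ * Real.sqrt (Real.log A₀))) + 12 * (3 / 2 * Real.log X) / Real.sqrt A₀ := by positivity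
  have hδ0 : 0 ≤ 1 + (Cθ * Real.exp (-cθ * Real.sqrt (τ * Real.log X)) + (8 + 2 * Cθ) / (hbXi τ * Real.log X)) := by positivity
  have hB₁0 : 0 ≤ bB1 X τ m c₃ V A₀ C₉ c₉ Cθ cθ := by rw [bB1]; positivity
  have hB₂0 : 0 ≤ bB2 X τ m c₃ V c₁ c₂ C₄ := by rw [bB2]; positivity
  set main : ℝ × ℝ × ℝ → ℝ := fun x => (wMeas X τ m (normForm x + Δ * V) - wMeas X τ m (normForm x)) / M₀ with hmaindef
  have hErr : ∀ x ∈ realCube a S₀, ‖Esum X τ m hq χ Δ V x - (if χ = 1 then ((Δ ^ 2 * main x : ℝ) : ℂ) else 0)‖ ≤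
      bErr X τ m c₃ V Δ K₀ A₀ C₉ c₉ Cθ cθ c₁ c₂ C₄ := by
    intro x hx
    obtain ⟨hNx1, hNx0⟩ := hN₁ x hx
    -- `B₁`
    have hB₁ : ∀ j k : ℤ, j ∈ Finset.Ioo (-(K₀ : ℤ)) K₀ → k ∈ Finset.Ioo (-(K₀ : ℤ)) K₀ →
        ¬ IsTrivialMod q (grossenChar hq χ j k) → ‖Ejk X τ m hq χ j k Δ V x‖ ≤ bB1 X τ m c₃ V A₀ C₉ c₉ Cθ cθ := by
      intro j k hj hk hnt
      refine (norm_Ejk_le_of_theta hq χ j k hcθ hCθ hθ₁ hX hτ hτ1 h3 hm hA₀ hA₀X hc₉ hC₉ (hθ χ j k hj hk hnt) hΔV hNx0).trans ?_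
      rw [bB1, ← hMdef]
      have hden : 0 < M * (hbXi τ * Real.log X) := by positivity
      refine div_le_div_of_nonneg_right ?_ hden.le
      exact mul_le_mul_of_nonneg_right (mul_le_mul_of_nonneg_right hNx1 hF0) (pow_nonneg hδ0 n)
    -- `B₂` and `Eabs`
    have herrx : 2 * (C₄ * ((n : ℝ) + 1) * (normForm x + Δ * V) * (c₁ + hbXi τ * Real.log X) ^ n *
        Real.exp (-c₂ * Real.sqrt (τ * Real.log X))) / ((∏ i, (m i : ℝ)) * (hbXi τ * Real.log X) ^ (n + 1)) ≤
        bB2 X τ m c₃ V c₁ c₂ C₄ := by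
      rw [bB2]
      refine div_le_div_of_nonneg_right ?_ (by positivity)
      have h0 : 0 ≤ (c₁ + hbXi τ * Real.log X) ^ n * Real.exp (-c₂ * Real.sqrt (τ * Real.log X)) := by positivity
      have : C₄ * ((n : ℝ) + 1) * (normForm x + Δ * V) ≤ C₄ * ((n : ℝ) + 1) * nMax c₃ V :=
        mul_le_mul_of_nonneg_left hNx1 (by positivity)
      nlinarith
    have hB₂ : χ = 1 → ‖Ejk X τ m hq χ 0 0 Δ V x - main x‖ ≤ bB2 X τ m c₃ V c₁ c₂ C₄ := by
      intro h1; subst h1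
      exact (norm_Ejk_one_sub_main_le h410 hc₁ hC₄ hX hτ hτ1 h3 hm hq hqX hΔV hNx0).trans herrx
    have hEabs : Eabs X τ m Δ V x ≤ bEA X τ m c₃ V Δ c₁ c₂ C₄ := by
      have h1 := abs_Eabs_sub_main_le h410 hc₁ hC₄ hX hτ hτ1 h3 hm hΔV hNx0
      rw [abs_le] at h1
      have hmx := (wMeas_window_le (X := X) (τ := τ) (m := m) hX.le hτ.le (t := normForm x) hΔV).2
      rw [bEA, ← hMdef]
      have hratio : (wMeas X τ m (normForm x + Δ * V) - wMeas X τ m (normForm x)) / (M * (hbXi τ * Real.log X) ^ (n + 1)) ≤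
          Δ * V / (M * (hbXi τ * Real.log X)) := by
        rw [div_le_div_iff₀ (by positivity) (by positivity)]
        calc (wMeas X τ m (normForm x + Δ * V) - wMeas X τ m (normForm x)) * (M * (hbXi τ * Real.log X))
            ≤ Δ * V * (hbXi τ * Real.log X) ^ n * (M * (hbXi τ * Real.log X)) :=
              mul_le_mul_of_nonneg_right hmx (by positivity)
          _ = Δ * V * (M * (hbXi τ * Real.log X) ^ (n + 1)) := by ring
      rw [hMdef] at hratio ⊢
      linarith [h1.2, herrx]
    -- Lemma 9.3
    have h93 := norm_Esum_sub_main_le (X := X) (τ := τ) (m := m) hq χ hΔ hΔ2 hNx0.ne' hK hε hB₁0 hB₂0 hB₁ hB₂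
    refine h93.trans ?_
    rw [bErr]
    have hSum := sum_norm_tentCoeff_le hΔ K₀
    have hSum0 : 0 ≤ ∑ j ∈ Finset.Ioo (-(K₀ : ℤ)) K₀, ‖tentCoeff Δ j‖ := Finset.sum_nonneg fun _ _ => norm_nonneg _
    have hEabs0 : 0 ≤ Eabs X τ m Δ V x := by
      rw [Eabs]; exact Finset.sum_nonneg fun P _ => by split_ifs <;> [exact abs_nonneg _; exact le_rfl]
    have hε0 : 0 ≤ 1 / Δ / Real.sqrt K₀ := by positivity
    have h1 : 3 * (1 / Δ / Real.sqrt K₀) * Eabs X τ m Δ V x ≤ 3 * (1 / Δ / Real.sqrt K₀) * bEA X τ m c₃ V Δ c₁ c₂ C₄ :=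
      mul_le_mul_of_nonneg_left hEabs (by positivity)
    have h2 : ((∑ j ∈ Finset.Ioo (-(K₀ : ℤ)) K₀, ‖tentCoeff Δ j‖) ^ 2 + 1) * bB1 X τ m c₃ V A₀ C₉ c₉ Cθ cθ ≤
        ((1 + 1 / Δ) ^ 2 + 1) * bB1 X τ m c₃ V A₀ C₉ c₉ Cθ cθ := by
      apply mul_le_mul_of_nonneg_right _ hB₁0
      nlinarith
    linarith
  -- (iv) `𝓙` through Lemma 9.3
  have hint := integrableOn_phaseFn_mul_Esum (X := X) (τ := τ) (m := m) hq χ h95 hC₀ hc₄ hV hΔ hΔ16 hΔc2 hκ hcube hrle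
  have hmwin := integrableOn_wMeas_window hX.le hτ.le m hΔV a hS₀.le
  have hmain : IntegrableOn main (realCube a S₀) := hmwin.div_const M₀
  have hiii' := norm_Jint_sub_main_le hq χ hS₀.le hint hmain hErr
  set Im : ℝ := ∫ x in realCube a S₀, (wMeas X τ m (normForm x + Δ * V) - wMeas X τ m (normForm x)) with hImdef
  have hIm : ∫ x in realCube a S₀, main x = Im / M₀ := by rw [hImdef, hmaindef, integral_div]
  rw [hIm] at hiii'
  -- (v) the window integral
  have hiv : |Im - Δ * V * cubeIntegral X τ m a S₀| ≤ bErr8 X τ (n := n) c₃ c₄ V Δ S₀ := by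
    rw [bErr8, hImdef]
    have hA : 0 ≤ Δ * V * (2 * (18 * (Δ * V) * S₀ ^ 2 * (c₃ * V ^ (1 / 3 : ℝ)) / (c₄ * V))) := by positivity
    have hB : 0 ≤ 2 * Δ ^ 2 * V / c₄ * (hbXi τ * Real.log X) ^ (n - 1) * S₀ ^ 3 := by positivity
    cases n with
    | zero =>
      exact (abs_integral_window_sub_le_of_one hX.le hτ.le m hc₃ hc₄ hV hΔ.le hS₀.le hcube).trans (by linarith)
    | succ n' =>
      exact (abs_integral_window_sub_le hX.le hτ.le m hc₄ hV hΔ.le hS₀.le hcube).trans (by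
        simp only [Nat.add_sub_cancel]; linarith)
  -- (vi) combine
  have hfin := norm_Tchi_sub_main_le (X := X) (τ := τ) (m := m) χ hΔ hV hM₀ hi hii hiii' hiv
  rw [lemma92Bound, ← hMdef, ← hM₀def]
  exact hfin

/-! ### (9.1): orthogonality of the characters `mod q` -/

section Orthogonality

variable {q : ℕ}

/-- `ℂ` has enough roots of unity for the (finite) unit group of `𝓞_K/(q)`. [folklore] -/
theorem hasEnoughRootsOfUnity_quotMod (hq : 1 ≤ q) : HasEnoughRootsOfUnity ℂ (Monoid.exponent (QuotMod q)ˣ) := by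
  haveI := finite_quotMod hq
  haveI : NeZero ((Monoid.exponent (QuotMod q)ˣ : ℕ) : ℂ) := ⟨Nat.cast_ne_zero.mpr Monoid.exponent_ne_zero_of_finite⟩
  infer_instance

open scoped Classical in
/-- **Orthogonality, first form**: `∑_χ χ(b) = φ_K(q)` if `b = 1`, `0` otherwise. [folklore] -/
theorem sum_mulChar_apply_eq (hq : 1 ≤ q) [Fintype (MulChar (QuotMod q) ℂ)] (b : QuotMod q) :
    ∑ χ : MulChar (QuotMod q) ℂ, χ b = if b = 1 then (eulerPhiK q : ℂ) else 0 := by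
  haveI := finite_quotMod hq
  haveI := hasEnoughRootsOfUnity_quotMod hq
  split_ifs with hb
  · rw [hb]
    simp only [map_one, Finset.sum_const, Finset.card_univ, nsmul_eq_mul, mul_one]
    rw [← Nat.card_eq_fintype_card, MulChar.card_eq_card_units_of_hasEnoughRootsOfUnity (QuotMod q) ℂ, eulerPhiK]
  · obtain ⟨χ, hχ⟩ := MulChar.exists_apply_ne_one_of_hasEnoughRootsOfUnity (QuotMod q) ℂ hb
    refine eq_zero_of_mul_eq_self_left hχ ?_
    simp only [Finset.mul_sum, ← MulChar.mul_apply]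
    exact Fintype.sum_bijective _ (Group.mulLeft_bijective χ) _ _ fun χ' => rfl

open scoped Classical in
/-- **Orthogonality (9.1)**: for `a` a unit, `∑_χ χ(a)⁻¹ χ(b) = φ_K(q)·[a = b]`. [cite: HeathBrownActa2001, §9 (9.1)] -/
theorem sum_mulChar_inv_mul_eq (hq : 1 ≤ q) [Fintype (MulChar (QuotMod q) ℂ)] {a : QuotMod q} (ha : IsUnit a) (b : QuotMod q) :
    ∑ χ : MulChar (QuotMod q) ℂ, (χ a)⁻¹ * χ b = if a = b then (eulerPhiK q : ℂ) else 0 := by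
  obtain ⟨u, rfl⟩ := ha
  have hinv : ∀ χ : MulChar (QuotMod q) ℂ, (χ (u : QuotMod q))⁻¹ = χ ((u⁻¹ : (QuotMod q)ˣ) : QuotMod q) := by
    intro χ
    have h1 : χ ((u⁻¹ : (QuotMod q)ˣ) : QuotMod q) * χ (u : QuotMod q) = 1 := by
      rw [← map_mul, Units.inv_mul, map_one]
    exact inv_eq_of_mul_eq_one_left h1
  simp_rw [hinv, ← map_mul]
  rw [sum_mulChar_apply_eq hq]
  have hiff : ((u⁻¹ : (QuotMod q)ˣ) : QuotMod q) * b = 1 ↔ (u : QuotMod q) = b := by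
    rw [Units.inv_mul_eq_one, eq_comm]
  by_cases h : (u : QuotMod q) = b
  · rw [if_pos (hiff.mpr h), if_pos h]
  · rw [if_neg (fun h' => h (hiff.mp h')), if_neg h]

/-- **The class sum through the characters** ((9.1)): for `α` coprime to `q`,
`∑_{β̂∈𝒞, β ≡ α (q)} d_{(β)} = φ_K(q)⁻¹ ∑_χ χ(α)⁻¹ T(χ)`. [cite: HeathBrownActa2001, §9 (9.1)] -/
theorem cubeClassSum_eq_sum_Tchi (hq : 1 ≤ q) [Fintype (MulChar (QuotMod q) ℂ)] {X τ : ℝ} {n : ℕ} (m : Fin (n + 1) → ℕ)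
    {α : 𝓞 K} (hα : IsCoprime α (q : 𝓞 K)) (a : ℝ × ℝ × ℝ) (S₀ : ℝ) :
    (cubeClassSum (dWeight X τ m) q α a S₀ : ℂ) =
      (eulerPhiK q : ℂ)⁻¹ * ∑ χ : MulChar (QuotMod q) ℂ, (χ (toQuotMod q α))⁻¹ * Tchi χ X τ m a S₀ := by
  classical
  have hunit : IsUnit (toQuotMod q α) := (isUnit_toQuotMod_iff α).mpr hα
  haveI := finite_quotMod hq
  have hφ : (eulerPhiK q : ℂ) ≠ 0 := by
    have : 0 < eulerPhiK q := by rw [eulerPhiK]; exact Nat.card_pos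
    exact_mod_cast this.ne'
  have hinner : ∀ v : ℤ × ℤ × ℤ, ∑ χ : MulChar (QuotMod q) ℂ, (χ (toQuotMod q α))⁻¹ *
      ((dWeight X τ m (Ideal.span {coordElt v}) : ℂ) * χ (toQuotMod q (coordElt v))) =
      (dWeight X τ m (Ideal.span {coordElt v}) : ℂ) * (if toQuotMod q α = toQuotMod q (coordElt v) then (eulerPhiK q : ℂ) else 0) := by
    intro v
    rw [← sum_mulChar_inv_mul_eq hq hunit, Finset.mul_sum]
    refine Finset.sum_congr rfl fun χ _ => by ring
  have h1 : ∑ χ : MulChar (QuotMod q) ℂ, (χ (toQuotMod q α))⁻¹ * Tchi χ X τ m a S₀ =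
      ∑ v ∈ latticeCube a S₀, (dWeight X τ m (Ideal.span {coordElt v}) : ℂ) *
        (if toQuotMod q α = toQuotMod q (coordElt v) then (eulerPhiK q : ℂ) else 0) := by
    simp only [Tchi, Finset.mul_sum]
    rw [Finset.sum_comm]
    exact Finset.sum_congr rfl fun v _ => hinner v
  rw [h1, Finset.mul_sum, cubeClassSum, Finset.sum_filter, Complex.ofReal_sum]
  refine Finset.sum_congr rfl fun v _ => ?_
  have hiff : (q : 𝓞 K) ∣ coordElt v - α ↔ toQuotMod q α = toQuotMod q (coordElt v) := by
    rw [eq_comm, toQuotMod, Ideal.Quotient.eq, Ideal.mem_span_singleton]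
  by_cases h : (q : 𝓞 K) ∣ coordElt v - α
  · rw [if_pos h, if_pos (hiff.mp h)]; field_simp
  · rw [if_neg h, if_neg (fun h' => h (hiff.mpr h')), mul_zero, mul_zero, Complex.ofReal_zero]

end Orthogonality

/-! ### Lemma 9.2 on one cube -/

/-- **Lemma 9.2 on one cube, explicit**: for `α` coprime to `q`,
`|∑_{β̂∈𝒞, β≡α (q)} d_{(β)} − 𝓘/(γ₀Mφ_K(q)(ξ log X)^{n+1})| ≤ lemma92Bound` ((9.1) and the bound for each `χ`).
[cite: HeathBrownActa2001, Lemma 9.2] -/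
theorem abs_cubeClassSum_sub_swMainTerm_le_bound
    {C₀ : ℝ} (h95 : Lemma95Bound C₀) (hC₀ : 0 < C₀)
    {c₁ c₂ C₄ : ℝ} (h410 : TupleCountBound c₁ c₂ C₄) (hc₁ : 0 ≤ c₁) (hC₄ : 0 ≤ C₄)
    {cθ Cθ : ℝ} (hcθ : 0 ≤ cθ) (hCθ : 0 ≤ Cθ)
    (hθ₁ : ∀ x : ℝ, 2 ≤ x → |degreeOneTheta K x - x| ≤ Cθ * x * Real.exp (-cθ * Real.sqrt (Real.log x)))
    {X τ : ℝ} (hX : 1 < X) (hτ : 0 < τ) (hτ1 : τ ≤ 1) (h3 : 3 ≤ X ^ τ) {n : ℕ} {m : Fin (n + 1) → ℕ} (hm : CoreAdmissible τ m)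
    {q : ℕ} (hq : 1 ≤ q) (hqX : (q : ℝ) ^ 3 < X ^ τ)
    {K₀ : ℕ} (hK : 1 ≤ K₀) {A₀ C₉ c₉ : ℝ} (hA₀ : 1 ≤ A₀) (hA₀X : A₀ + 1 ≤ X ^ τ) (hc₉ : 0 ≤ c₉) (hC₉ : 0 ≤ C₉)
    (hθ : ∀ (ψ : MulChar (QuotMod q) ℂ) (j k : ℤ), j ∈ Finset.Ioo (-(K₀ : ℤ)) K₀ → k ∈ Finset.Ioo (-(K₀ : ℤ)) K₀ →
      ¬ IsTrivialMod q (grossenChar hq ψ j k) → ∀ u : ℝ, A₀ ≤ u →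
        ‖grossenTheta (grossenChar hq ψ j k) u‖ ≤ C₉ * u * Real.exp (-(c₉ * Real.sqrt (Real.log u))))
    {c₃ c₄ V Δ : ℝ} (hc₃ : 0 < c₃) (hc₄ : 0 < c₄) (hV : 0 < V) {a : ℝ × ℝ × ℝ} {S₀ : ℝ} (hS₀ : 0 < S₀)
    (hcube : CubeCond c₃ c₄ V a S₀) (hΔ : 0 < Δ) (hΔ16 : Δ ≤ 1 / 16) (hΔc : Δ ≤ c₄ / 4)
    (hκ : C₀ * (1 + 1 / c₄) * Δ ≤ 1 / 2) (hε : 1 / Δ / Real.sqrt K₀ ≤ 1) {α : 𝓞 K} (hα : IsCoprime α (q : 𝓞 K)) :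
    |cubeClassSum (dWeight X τ m) q α a S₀ - swMainTerm X τ m q a S₀| ≤
      lemma92Bound X τ m c₃ c₄ V Δ S₀ K₀ A₀ C₉ c₉ Cθ cθ c₁ c₂ C₄ C₀ := by
  classical
  haveI := finite_quotMod hq
  haveI := hasEnoughRootsOfUnity_quotMod hq
  haveI : Fintype (MulChar (QuotMod q) ℂ) := Fintype.ofFinite _
  have hcard : (Fintype.card (MulChar (QuotMod q) ℂ) : ℝ) = eulerPhiK q := by
    rw [← Nat.card_eq_fintype_card, MulChar.card_eq_card_units_of_hasEnoughRootsOfUnity (QuotMod q) ℂ, eulerPhiK]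
  have hφpos : 0 < (eulerPhiK q : ℝ) := by
    have : 0 < eulerPhiK q := by rw [eulerPhiK]; exact Nat.card_pos
    exact_mod_cast this
  have hunit : IsUnit (toQuotMod q α) := (isUnit_toQuotMod_iff α).mpr hα
  set B := lemma92Bound X τ m c₃ c₄ V Δ S₀ K₀ A₀ C₉ c₉ Cθ cθ c₁ c₂ C₄ C₀ with hB
  set MT : ℝ := cubeIntegral X τ m a S₀ / (gamma₀ * ((∏ i, (m i : ℝ)) * (hbXi τ * Real.log X) ^ (n + 1))) with hMT
  have hχ : ∀ χ : MulChar (QuotMod q) ℂ, ‖Tchi χ X τ m a S₀ - (if χ = 1 then ((MT : ℝ) : ℂ) else 0)‖ ≤ B := fun χ =>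
    norm_Tchi_sub_le_bound h95 hC₀ h410 hc₁ hC₄ hcθ hCθ hθ₁ hX hτ hτ1 h3 hm hq hqX χ hK hA₀ hA₀X hc₉ hC₉ hθ hc₃ hc₄ hV hS₀
      hcube hΔ hΔ16 hΔc hκ hε
  -- the main term through the characters
  have hsw : (swMainTerm X τ m q a S₀ : ℂ) =
      (eulerPhiK q : ℂ)⁻¹ * ∑ χ : MulChar (QuotMod q) ℂ, (χ (toQuotMod q α))⁻¹ * (if χ = 1 then ((MT : ℝ) : ℂ) else 0) := by
    have hs : ∑ χ : MulChar (QuotMod q) ℂ, (χ (toQuotMod q α))⁻¹ * (if χ = 1 then ((MT : ℝ) : ℂ) else 0) =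
        ∑ χ : MulChar (QuotMod q) ℂ, (if χ = 1 then ((MT : ℝ) : ℂ) else 0) := by
      refine Finset.sum_congr rfl fun χ _ => ?_
      split_ifs with h1
      · rw [h1, MulChar.one_apply hunit, inv_one, one_mul]
      · rw [mul_zero]
    rw [hs, Finset.sum_ite_eq', if_pos (Finset.mem_univ _), swMainTerm, hMT]
    have hφC : (eulerPhiK q : ℂ) ≠ 0 := by exact_mod_cast hφpos.ne'
    have hγC : (gamma₀ : ℂ) ≠ 0 := by exact_mod_cast gamma₀_pos.ne'
    push_cast
    field_simp
  have hdiff : ((cubeClassSum (dWeight X τ m) q α a S₀ - swMainTerm X τ m q a S₀ : ℝ) : ℂ) =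
      (eulerPhiK q : ℂ)⁻¹ * ∑ χ : MulChar (QuotMod q) ℂ, (χ (toQuotMod q α))⁻¹ *
        (Tchi χ X τ m a S₀ - (if χ = 1 then ((MT : ℝ) : ℂ) else 0)) := by
    rw [Complex.ofReal_sub, cubeClassSum_eq_sum_Tchi hq m hα, hsw, ← mul_sub, ← Finset.sum_sub_distrib]
    congr 1
    refine Finset.sum_congr rfl fun χ _ => by ring
  rw [← Real.norm_eq_abs, ← Complex.norm_real, hdiff, norm_mul, norm_inv, Complex.norm_natCast]
  have hsum : ‖∑ χ : MulChar (QuotMod q) ℂ, (χ (toQuotMod q α))⁻¹ * (Tchi χ X τ m a S₀ - (if χ = 1 then ((MT : ℝ) : ℂ) else 0))‖ ≤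
      (eulerPhiK q : ℝ) * B := by
    refine (norm_sum_le _ _).trans ?_
    have hterm : ∀ χ ∈ (Finset.univ : Finset (MulChar (QuotMod q) ℂ)),
        ‖(χ (toQuotMod q α))⁻¹ * (Tchi χ X τ m a S₀ - (if χ = 1 then ((MT : ℝ) : ℂ) else 0))‖ ≤ B := by
      intro χ _
      obtain ⟨u, hu⟩ := hunit
      have hn : ‖(χ (toQuotMod q α))⁻¹‖ = 1 := by rw [norm_inv, ← hu, norm_mulChar_apply_units hq χ u, inv_one]
      rw [norm_mul, hn, one_mul]
      exact hχ χ
    refine (Finset.sum_le_sum hterm).trans ?_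
    rw [Finset.sum_const, Finset.card_univ, nsmul_eq_mul, hcard]
  calc (eulerPhiK q : ℝ)⁻¹ * ‖∑ χ : MulChar (QuotMod q) ℂ, (χ (toQuotMod q α))⁻¹ *
        (Tchi χ X τ m a S₀ - (if χ = 1 then ((MT : ℝ) : ℂ) else 0))‖
      ≤ (eulerPhiK q : ℝ)⁻¹ * ((eulerPhiK q : ℝ) * B) := mul_le_mul_of_nonneg_left hsum (inv_nonneg.mpr hφpos.le)
    _ = B := by field_simp

end Literature.NumberTheory.Sieve.CubicSieve
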